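import Mathlib

/-!
# `NoHeavyLowerTail` (stmt-CriticalPhenomena-4575) — the one-sided log-derivative schema ("M⁻-schema")
# for cubic edge/coordinate steps (HQT / AG⁺ / SHK3⁺ and Sahi's E₃)

Support file (new-inequality factory seat `prim-ineq-gen-4` gen 5; `--supports stmt-CriticalPhenomena-4575`).
No definitions, no named facts, no sorries: calculus on `ℝ` and `ring` identities.

SETTING (memo run/shared/lean/prim/prim-ineq-gen-4/FINDING-PRODUCT-FORM-SAHI-g5.md §II).  Along one edge `e`
(weight `p`) of a weighted graph — or one coordinate of a product measure — every cubic three-point / three-function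
functional (HQT `(q+t)(qt−e₂)−e₃`, AG⁺, SHK3⁺ = Sahi's `E₃` of the pairwise separations, Sahi's `E₃(f,g,h)` itself)
is a cubic `f(p) = β₀(1−p)³ + 3β₁p(1−p)² + 3β₂p²(1−p) + β₃p³` whose end values `β₀ = f(0)`, `β₃ = f(1)` are the
functional of the edge-deleted / edge-contracted system (induction hypotheses) and whose mixed Bernstein coefficients
`β₁, β₂` are the open "step" quantities (bern4's `(B1),(B2)`; `CubicThreePointStep.threeB₁/threeB₂`).  Gen 4's Conjecture M
(`StrongHarrisCubicStep.logDeriv_form`) asks for `3β₁ ≥ β₀` AND `3β₂ ≥ β₃`.  The point recorded here: **one side suffices.**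
* `bernstein_logDeriv_at_zero` — for the Bernstein cubic, `2f(0) + f′(0) = 3β₁ − β₀` ("M⁻ at `p = 0`" is `3β₁ ≥ β₀`);
  `bernstein_logDeriv_at_one` — `2f(1) − f′(1) = 3β₂ − β₃`.
* `ge_sq_mul_of_logDeriv_nonneg` — **ODE comparison**: if `f` is differentiable and `2f(p) + (1−p)f′(p) ≥ 0` for all
  `p ∈ [0,1)`, then `f(p) ≥ (1−p)²·f(0)` on `[0,1)` (the quotient `f/(1−p)²` is nondecreasing);
  `nonneg_of_logDeriv_nonneg` — hence `f ≥ 0` on `[0,1]` as soon as `f(0) ≥ 0` (continuity at `p = 1`).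
  Dually `ge_sq_mul_of_logDeriv_nonneg'`: `2f − pf′ ≥ 0` on `(0,1]` gives `f(p) ≥ p²f(1)`.
* `logDeriv_reparam` — "M⁻ at weight `a`" is "M⁻ at weight `0` after re-parametrising the remaining weight":
  with `g(s) = f(a + (1−a)s)`, `2g(0) + g′(0) = 2f(a) + (1−a)f′(a)`.  For a graph edge this is the observation that
  raising `w_e` from `a` is adding a parallel edge, so the HYPOTHESIS "3β₁ ≥ β₀ for every weighted graph and every edge at
  a terminal" already gives `2f + (1−p)f′ ≥ 0` at every `p`, hence (with `f(0) ≥ 0` by induction on the number of edges)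
  `f ≥ 0`: HQT / SHK3⁺ for all graphs follow from the single endpoint inequality `3β₁ ≥ β₀` (for terminal–Steiner edges a
  pure 4-point statement, memo §II; for terminal–terminal edges proved below).
* `terminalEdge_bernstein`, `terminalEdge_M_minus`, `terminalEdge_M_minus_nonneg` — for a terminal–terminal edge
  `e = ab` the Bernstein coefficients of `p ↦ HQT` are explicit polynomials in the five cells `(q,u₁,u₂,u₃,t)` of `G∖e`, and
  `3β₁ − β₀ = (t+u₂+u₃)·(qt − e₂(u)) + t·u₂u₃ ≥ 0` by Gladkov's `qt ≥ e₂` (tree: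
  `Literature.Probability.LatticeModels.prodBernoulli_threePoint_strongHarris`, used here only as the hypothesis `0 ≤ qt − e₂`).
Census behind the hypothesis (memo §I/§III): the coefficientwise ("comb") refinement `c₁ ≥ c₀`, `c₂ ≥ c₃` of M holds for
HQT/AG⁺/SHK3⁺ on every edge of 70+ graphs and for Sahi's `E₃` on ALL 804 440 up-set triples of `{0,1}⁴` (exhaustive).
-/

noncomputable section

namespace Summit.CriticalPhenomena.PercolationContinuityZ3.Theorems

namespace LogDerivSchema

open Set

/-- Derivative of a cubic written in the monomial basis. [folklore] -/
theorem cubic_hasDerivAt (c₀ c₁ c₂ c₃ p : ℝ) :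
    HasDerivAt (fun p : ℝ => c₀ + c₁ * p + c₂ * p ^ 2 + c₃ * p ^ 3) (c₁ + 2 * c₂ * p + 3 * c₃ * p ^ 2) p := by
  have h0 : HasDerivAt (fun _ : ℝ => c₀) 0 p := hasDerivAt_const p c₀
  have h1 : HasDerivAt (fun p : ℝ => c₁ * p) (c₁ * 1) p := (hasDerivAt_id' p).const_mul c₁
  have h2 : HasDerivAt (fun p : ℝ => c₂ * p ^ 2) (c₂ * (↑(2 : ℕ) * p ^ (2 - 1) * 1)) p :=
    ((hasDerivAt_id' p).pow 2).const_mul c₂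
  have h3 : HasDerivAt (fun p : ℝ => c₃ * p ^ 3) (c₃ * (↑(3 : ℕ) * p ^ (3 - 1) * 1)) p :=
    ((hasDerivAt_id' p).pow 3).const_mul c₃
  have h := ((h0.add h1).add h2).add h3
  have e : c₁ + 2 * c₂ * p + 3 * c₃ * p ^ 2
      = 0 + c₁ * 1 + c₂ * (↑(2 : ℕ) * p ^ (2 - 1) * 1) + c₃ * (↑(3 : ℕ) * p ^ (3 - 1) * 1) := by
    push_cast
    ring
  rw [e]
  exact h

/-- The Bernstein cubic in the monomial basis. [folklore] -/
theorem bernstein_eq_cubic (β₀ β₁ β₂ β₃ : ℝ) :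
    (fun p : ℝ => β₀ * (1 - p) ^ 3 + 3 * β₁ * p * (1 - p) ^ 2 + 3 * β₂ * p ^ 2 * (1 - p) + β₃ * p ^ 3)
      = fun p : ℝ => β₀ + (3 * β₁ - 3 * β₀) * p + (3 * β₀ - 6 * β₁ + 3 * β₂) * p ^ 2
          + (β₃ - β₀ + 3 * β₁ - 3 * β₂) * p ^ 3 := by
  funext p
  ring

/-- Derivative of the Bernstein cubic `β₀(1−p)³ + 3β₁p(1−p)² + 3β₂p²(1−p) + β₃p³` (packaged as `HasDerivAt`).
[folklore] -/
theorem bernstein_hasDerivAt (β₀ β₁ β₂ β₃ p : ℝ) :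
    HasDerivAt (fun p : ℝ => β₀ * (1 - p) ^ 3 + 3 * β₁ * p * (1 - p) ^ 2 + 3 * β₂ * p ^ 2 * (1 - p) + β₃ * p ^ 3)
      ((3 * β₁ - 3 * β₀) + 2 * (3 * β₀ - 6 * β₁ + 3 * β₂) * p + 3 * (β₃ - β₀ + 3 * β₁ - 3 * β₂) * p ^ 2) p := by
  rw [bernstein_eq_cubic]
  exact cubic_hasDerivAt _ _ _ _ p

/-- **M⁻ at `p = 0` is `3β₁ ≥ β₀`**: for the Bernstein cubic `f`, `2f(0) + (1−0)f′(0) = 3β₁ − β₀`. [this file] -/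
theorem bernstein_logDeriv_at_zero (β₀ β₁ β₂ β₃ : ℝ) :
    2 * (fun p : ℝ => β₀ * (1 - p) ^ 3 + 3 * β₁ * p * (1 - p) ^ 2 + 3 * β₂ * p ^ 2 * (1 - p) + β₃ * p ^ 3) 0
      + (1 - 0) * deriv (fun p : ℝ => β₀ * (1 - p) ^ 3 + 3 * β₁ * p * (1 - p) ^ 2
        + 3 * β₂ * p ^ 2 * (1 - p) + β₃ * p ^ 3) 0 = 3 * β₁ - β₀ := by
  rw [(bernstein_hasDerivAt β₀ β₁ β₂ β₃ 0).deriv]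
  ring

/-- **M⁺ at `p = 1` is `3β₂ ≥ β₃`**: `2f(1) − 1·f′(1) = 3β₂ − β₃`. [this file] -/
theorem bernstein_logDeriv_at_one (β₀ β₁ β₂ β₃ : ℝ) :
    2 * (fun p : ℝ => β₀ * (1 - p) ^ 3 + 3 * β₁ * p * (1 - p) ^ 2 + 3 * β₂ * p ^ 2 * (1 - p) + β₃ * p ^ 3) 1
      - 1 * deriv (fun p : ℝ => β₀ * (1 - p) ^ 3 + 3 * β₁ * p * (1 - p) ^ 2
        + 3 * β₂ * p ^ 2 * (1 - p) + β₃ * p ^ 3) 1 = 3 * β₂ - β₃ := by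
  rw [(bernstein_hasDerivAt β₀ β₁ β₂ β₃ 1).deriv]
  ring

/-- **ODE comparison (the M⁻-schema).** If `f` is differentiable and `2f(p) + (1−p)f′(p) ≥ 0` for every
`p ∈ [0,1)`, then `(1−p)²·f(0) ≤ f(p)` for every `p ∈ [0,1)`: the quotient `f/(1−p)²` is nondecreasing there
(`monotoneOn_of_deriv_nonneg`). [folklore; Grönwall-type comparison] -/
theorem ge_sq_mul_of_logDeriv_nonneg {f : ℝ → ℝ} (hf : Differentiable ℝ f)
    (hM : ∀ p ∈ Ico (0 : ℝ) 1, 0 ≤ 2 * f p + (1 - p) * deriv f p) :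
    ∀ p ∈ Ico (0 : ℝ) 1, (1 - p) ^ 2 * f 0 ≤ f p := by
  set g : ℝ → ℝ := fun p => f p / (1 - p) ^ 2 with hg
  have hden : ∀ p ∈ Ico (0 : ℝ) 1, (1 - p) ^ 2 ≠ 0 := fun p hp => by
    have : 0 < 1 - p := by linarith [hp.2]
    positivity
  have hderiv : ∀ p ∈ Ico (0 : ℝ) 1,
      HasDerivAt g ((deriv f p * (1 - p) ^ 2 - f p * (↑2 * (1 - p) ^ (2 - 1) * (-1))) / ((1 - p) ^ 2) ^ 2) p := by
    intro p hp
    have h1 : HasDerivAt (fun x : ℝ => (1 - x) ^ 2) (↑2 * (1 - p) ^ (2 - 1) * (-1)) p :=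
      ((hasDerivAt_id p).const_sub 1).pow 2
    exact (hf p).hasDerivAt.div h1 (hden p hp)
  have hmono : MonotoneOn g (Ico (0 : ℝ) 1) := by
    refine monotoneOn_of_deriv_nonneg (convex_Ico 0 1) ?_ ?_ ?_
    · exact fun p hp => (hderiv p hp).continuousAt.continuousWithinAt
    · rw [interior_Ico]
      exact fun p hp => (hderiv p (Ioo_subset_Ico_self hp)).differentiableAt.differentiableWithinAt
    · rw [interior_Ico]
      intro p hp
      have hp' : p ∈ Ico (0 : ℝ) 1 := Ioo_subset_Ico_self hp
      rw [(hderiv p hp').deriv]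
      have hpos : 0 < 1 - p := by linarith [hp.2]
      have hnum : 0 ≤ deriv f p * (1 - p) ^ 2 - f p * (↑2 * (1 - p) ^ (2 - 1) * (-1)) := by
        have hMp := hM p hp'
        have : deriv f p * (1 - p) ^ 2 - f p * (↑2 * (1 - p) ^ (2 - 1) * (-1))
            = (1 - p) * (2 * f p + (1 - p) * deriv f p) := by
          push_cast
          ring
        rw [this]
        positivity
      positivity
  intro p hp
  have h0 : (0 : ℝ) ∈ Ico (0 : ℝ) 1 := ⟨le_rfl, zero_lt_one⟩
  have hle : g 0 ≤ g p := hmono h0 hp hp.1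
  have hg0 : g 0 = f 0 := by simp [hg]
  have hpos : 0 < (1 - p) ^ 2 := by
    have : 0 < 1 - p := by linarith [hp.2]
    positivity
  rw [hg0] at hle
  have hle' : f 0 ≤ f p / (1 - p) ^ 2 := hle
  have := (le_div_iff₀ hpos).1 hle'
  linarith

/-- **Positivity from the one-sided schema.** If `f` is differentiable, `f(0) ≥ 0` and `2f + (1−p)f′ ≥ 0` on `[0,1)`,
then `f ≥ 0` on `[0,1]` (on `[0,1)` by `ge_sq_mul_of_logDeriv_nonneg`, at `p = 1` by continuity). [folklore] -/
theorem nonneg_of_logDeriv_nonneg {f : ℝ → ℝ} (hf : Differentiable ℝ f) (h0 : 0 ≤ f 0)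
    (hM : ∀ p ∈ Ico (0 : ℝ) 1, 0 ≤ 2 * f p + (1 - p) * deriv f p) :
    ∀ p ∈ Icc (0 : ℝ) 1, 0 ≤ f p := by
  have hIco : ∀ p ∈ Ico (0 : ℝ) 1, 0 ≤ f p := fun p hp =>
    le_trans (by positivity) (ge_sq_mul_of_logDeriv_nonneg hf hM p hp)
  have hclosed : IsClosed {p : ℝ | 0 ≤ f p} := isClosed_le continuous_const hf.continuous
  have hsub : Icc (0 : ℝ) 1 ⊆ {p : ℝ | 0 ≤ f p} := by
    have : closure (Ico (0 : ℝ) 1) ⊆ {p : ℝ | 0 ≤ f p} := hclosed.closure_subset_iff.2 hIco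
    rwa [closure_Ico zero_ne_one] at this
  exact fun p hp => hsub hp

/-- **Dual side (M⁺).** If `2f(p) − p·f′(p) ≥ 0` on `(0,1]` then `p²·f(1) ≤ f(p)` on `(0,1]`
(the M⁻ version applied to `q ↦ f(1−q)`). [folklore] -/
theorem ge_sq_mul_of_logDeriv_nonneg' {f : ℝ → ℝ} (hf : Differentiable ℝ f)
    (hM : ∀ p ∈ Ioc (0 : ℝ) 1, 0 ≤ 2 * f p - p * deriv f p) :
    ∀ p ∈ Ioc (0 : ℝ) 1, p ^ 2 * f 1 ≤ f p := by
  set h : ℝ → ℝ := fun q => f (1 - q) with hh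
  have hhd : Differentiable ℝ h := hf.comp ((differentiable_const 1).sub differentiable_id)
  have hderiv : ∀ q, deriv h q = -deriv f (1 - q) := by
    intro q
    have h1 : HasDerivAt (fun x : ℝ => 1 - x) (-1) q := by simpa using (hasDerivAt_id q).const_sub 1
    have hc : HasDerivAt h (deriv f (1 - q) * (-1)) q := (hf (1 - q)).hasDerivAt.comp q h1
    rw [hc.deriv]
    ring
  have hMh : ∀ q ∈ Ico (0 : ℝ) 1, 0 ≤ 2 * h q + (1 - q) * deriv h q := by
    intro q hq
    have hp : 1 - q ∈ Ioc (0 : ℝ) 1 := ⟨by linarith [hq.2], by linarith [hq.1]⟩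
    have := hM (1 - q) hp
    rw [hderiv q]
    have e : h q = f (1 - q) := rfl
    rw [e]
    linarith
  intro p hp
  have hq : 1 - p ∈ Ico (0 : ℝ) 1 := ⟨by linarith [hp.2], by linarith [hp.1]⟩
  have key := ge_sq_mul_of_logDeriv_nonneg hhd hMh (1 - p) hq
  have e1 : h (1 - p) = f p := by simp [hh]
  have e2 : h 0 = f 1 := by simp [hh]
  rw [e1, e2] at key
  have e3 : (1 - (1 - p)) ^ 2 = p ^ 2 := by ring
  rw [e3] at key
  exact key

/-- **Re-parametrisation.** With `g(s) = f(a + (1−a)s)` ("use up the remaining weight `1−a`"; for a graph edge: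
add a parallel edge of weight `s`), `2g(0) + (1−0)·g′(0) = 2f(a) + (1−a)f′(a)`.  So the endpoint condition M⁻@0 for
all systems of a class closed under this operation is M⁻ at every `p`. [this file] -/
theorem logDeriv_reparam {f : ℝ → ℝ} (hf : Differentiable ℝ f) (a : ℝ) :
    2 * (fun s : ℝ => f (a + (1 - a) * s)) 0 + (1 - 0) * deriv (fun s : ℝ => f (a + (1 - a) * s)) 0
      = 2 * f a + (1 - a) * deriv f a := by
  have hlin : HasDerivAt (fun s : ℝ => a + (1 - a) * s) ((1 - a) * 1) 0 :=
    ((hasDerivAt_id (0 : ℝ)).const_mul (1 - a)).const_add a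
  have hga : a + (1 - a) * 0 = a := by ring
  have hcomp : HasDerivAt (fun s : ℝ => f (a + (1 - a) * s)) (deriv f a * ((1 - a) * 1)) 0 := by
    have := (hf (a + (1 - a) * 0)).hasDerivAt.comp (0 : ℝ) hlin
    rw [hga] at this
    exact this
  rw [hcomp.deriv]
  simp only [mul_zero, add_zero, sub_zero, one_mul, mul_one]
  ring

/-! ### The terminal–terminal edge: M⁻ is an identity plus Gladkov's `qt ≥ e₂` -/

/-- **Bernstein form of `p ↦ HQT` along a terminal–terminal edge `e = ab`.**  Cells of `G∖e`:
`(q,u₁,u₂,u₃,t) = (P(a|b|c), P(ab|c), P(ac|b), P(bc|a), P(abc))`; the edge `ab` open with probability `p` moves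
`q → u₁` and `u₂, u₃ → t`, so the law is `((1−p)q, u₁+pq, (1−p)u₂, (1−p)u₃, t+p(u₂+u₃))`.  With
`HQT = (q+t)(qt − e₂(u)) − e₃(u)`:  `β₀ = HQT(q,u,t)`, `3β₁ = β₀ + (t+u₂+u₃)(qt−e₂) + t·u₂u₃`,
`3β₂ = q(t+u₂+u₃)² − (u₂+u₃)(u₁+q)(t+u₂+u₃)`, `β₃ = 0`. [this file] -/
theorem terminalEdge_bernstein (q u₁ u₂ u₃ t p : ℝ) :
    let HQT : ℝ → ℝ → ℝ → ℝ → ℝ → ℝ := fun q u₁ u₂ u₃ t =>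
      (q + t) * (q * t - (u₁ * u₂ + u₁ * u₃ + u₂ * u₃)) - u₁ * u₂ * u₃
    let β₀ := HQT q u₁ u₂ u₃ t
    let β₁ := (HQT q u₁ u₂ u₃ t + (t + u₂ + u₃) * (q * t - (u₁ * u₂ + u₁ * u₃ + u₂ * u₃)) + t * (u₂ * u₃)) / 3
    let β₂ := (q * (t + u₂ + u₃) ^ 2 - (u₂ + u₃) * (u₁ + q) * (t + u₂ + u₃)) / 3
    HQT ((1 - p) * q) (u₁ + p * q) ((1 - p) * u₂) ((1 - p) * u₃) (t + p * (u₂ + u₃))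
      = β₀ * (1 - p) ^ 3 + 3 * β₁ * p * (1 - p) ^ 2 + 3 * β₂ * p ^ 2 * (1 - p) + 0 * p ^ 3 := by
  intro HQT β₀ β₁ β₂
  simp only [HQT, β₀, β₁, β₂]
  ring

/-- **M⁻ for a terminal–terminal edge is an identity:** along `e = ab`, with `f(p) = HQT(law(p))`,
`2f(0) + (1−0)f′(0) = 3β₁ − β₀ = (t+u₂+u₃)·(qt − e₂(u)) + t·u₂u₃`. [this file] -/
theorem terminalEdge_M_minus (q u₁ u₂ u₃ t : ℝ) :
    2 * (fun p : ℝ => ((1 - p) * q + (t + p * (u₂ + u₃)))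
          * (((1 - p) * q) * (t + p * (u₂ + u₃))
            - ((u₁ + p * q) * ((1 - p) * u₂) + (u₁ + p * q) * ((1 - p) * u₃) + ((1 - p) * u₂) * ((1 - p) * u₃)))
          - (u₁ + p * q) * ((1 - p) * u₂) * ((1 - p) * u₃)) 0
      + (1 - 0) * deriv (fun p : ℝ => ((1 - p) * q + (t + p * (u₂ + u₃)))
          * (((1 - p) * q) * (t + p * (u₂ + u₃))
            - ((u₁ + p * q) * ((1 - p) * u₂) + (u₁ + p * q) * ((1 - p) * u₃) + ((1 - p) * u₂) * ((1 - p) * u₃)))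
          - (u₁ + p * q) * ((1 - p) * u₂) * ((1 - p) * u₃)) 0
      = (t + u₂ + u₃) * (q * t - (u₁ * u₂ + u₁ * u₃ + u₂ * u₃)) + t * (u₂ * u₃) := by
  set β₀ := (q + t) * (q * t - (u₁ * u₂ + u₁ * u₃ + u₂ * u₃)) - u₁ * u₂ * u₃ with hβ₀
  set β₁ := (β₀ + (t + u₂ + u₃) * (q * t - (u₁ * u₂ + u₁ * u₃ + u₂ * u₃)) + t * (u₂ * u₃)) / 3 with hβ₁
  set β₂ := (q * (t + u₂ + u₃) ^ 2 - (u₂ + u₃) * (u₁ + q) * (t + u₂ + u₃)) / 3 with hβ₂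
  have hfun : (fun p : ℝ => ((1 - p) * q + (t + p * (u₂ + u₃)))
          * (((1 - p) * q) * (t + p * (u₂ + u₃))
            - ((u₁ + p * q) * ((1 - p) * u₂) + (u₁ + p * q) * ((1 - p) * u₃) + ((1 - p) * u₂) * ((1 - p) * u₃)))
          - (u₁ + p * q) * ((1 - p) * u₂) * ((1 - p) * u₃))
      = (fun p : ℝ => β₀ * (1 - p) ^ 3 + 3 * β₁ * p * (1 - p) ^ 2 + 3 * β₂ * p ^ 2 * (1 - p) + 0 * p ^ 3) := by
    funext p
    simp only [hβ₀, hβ₁, hβ₂]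
    ring
  rw [hfun, bernstein_logDeriv_at_zero β₀ β₁ β₂ 0]
  simp only [hβ₁, hβ₀]
  ring

/-- **Hence M⁻ holds along every terminal–terminal edge**, given Gladkov's three-point inequality `qt ≥ e₂(u)`
for the law of `G∖e` (hypothesis `hAG`) and nonnegativity of the cells. [this file] -/
theorem terminalEdge_M_minus_nonneg {q u₁ u₂ u₃ t : ℝ} (hu₂ : 0 ≤ u₂) (hu₃ : 0 ≤ u₃) (ht : 0 ≤ t)
    (hAG : 0 ≤ q * t - (u₁ * u₂ + u₁ * u₃ + u₂ * u₃)) :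
    0 ≤ 2 * (fun p : ℝ => ((1 - p) * q + (t + p * (u₂ + u₃)))
          * (((1 - p) * q) * (t + p * (u₂ + u₃))
            - ((u₁ + p * q) * ((1 - p) * u₂) + (u₁ + p * q) * ((1 - p) * u₃) + ((1 - p) * u₂) * ((1 - p) * u₃)))
          - (u₁ + p * q) * ((1 - p) * u₂) * ((1 - p) * u₃)) 0
      + (1 - 0) * deriv (fun p : ℝ => ((1 - p) * q + (t + p * (u₂ + u₃)))
          * (((1 - p) * q) * (t + p * (u₂ + u₃))
            - ((u₁ + p * q) * ((1 - p) * u₂) + (u₁ + p * q) * ((1 - p) * u₃) + ((1 - p) * u₂) * ((1 - p) * u₃)))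
          - (u₁ + p * q) * ((1 - p) * u₂) * ((1 - p) * u₃)) 0 := by
  rw [terminalEdge_M_minus]
  have h1 : 0 ≤ (t + u₂ + u₃) * (q * t - (u₁ * u₂ + u₁ * u₃ + u₂ * u₃)) :=
    mul_nonneg (by linarith) hAG
  have h2 : 0 ≤ t * (u₂ * u₃) := mul_nonneg ht (mul_nonneg hu₂ hu₃)
  linarith

end LogDerivSchema

end Summit.CriticalPhenomena.PercolationContinuityZ3.Theorems
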